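import Literature.NumberTheory.Transcendental.PkappaTheta
import Mathlib.RingTheory.MvPolynomial.Homogeneous
import Mathlib.Analysis.Calculus.IteratedDeriv.Defs
import HarnessLib

/-!
# Philippon's zero estimate on the group varieties `M_κ = 𝔾ₘ^β × P_κ`

Topic: `Literature/NumberTheory/Transcendental`. Plan item W3 of the unit
`provefact-Literature.NumberTheory.Transcendental.H-b596640137` (fact
`Literature.NumberTheory.Transcendental.HuberWustholzOnePeriods`): the "deconstructive" half of
the proof of Baker–Wüstholz's Semistability Theorem (*Logarithmic Forms and Diophantine
Geometry*, Thm. 6.15; in the tree `semistabilityTheorem_std(_tors)`) is a multiplicity (zero)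
estimate on commutative group varieties. Baker–Wüstholz quote it as their Thm. 6.14 (from
Wüstholz 1989) in a "semistable form" whose printed statement is NOT correct as it stands — it
tacitly assumes that `ℤg` is Zariski dense in `G` (with `G = 𝔾ₘ²`, `V` an irrational line,
`g = (2, 2)` in the diagonal torus and `r = (X₁ - X₂)^{T+1}` all its hypotheses hold and its
conclusion fails; op. cit. p. 114 only rules out alternative (i) of their Thm. 5.7, not the
obstruction-subgroup alternative (ii)). We therefore vendor the general printed theorem with its
**obstruction subgroup**, Philippon 1986, Théorème 2.1, for the explicit groups `M_κ` in the
projective embedding by the theta functions of `PkappaTheta.lean` — as a NAMED FACT, nothing is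
asserted — together with the two notions the analytic half uses: `GaGmE.Std.thetaEval` (the entire
function `F_P = P(Θ)` on `Lie M_κ,ℂ` attached to a form `P`) and `GaGmE.Std.VanishesAlong` (order
of vanishing along a subspace); the semistable/dense packaging à la Baker–Wüstholz is then a
theorem to be PROVED from it (sequel).

## The printed theorem (Philippon 1986, §2, pp. 357–358; same reading as `PhilipponZeroEstimate.lean`)

`K = ℂ` (or `ℂ_ℓ`); `G = G₁ × ⋯ × G_p` commutative algebraic groups over `K` of dimensions
`n₁, …, n_p`, `n = ∑ nᵢ`, each `Gᵢ` embedded as a quasi-projective subvariety of `ℙ_{Nᵢ}`,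
`R = K[X]` the multihomogeneous coordinate ring; `Φ : K^d → G(K)` an analytic subgroup
(homomorphism analytic near `0`), `A = im Φ`; `Σ ⊂ G(K)` finite containing the origin,
`Σ(n) = {x₁ + ⋯ + x_n ; xᵢ ∈ Σ}`; `ord_g P` = order at `z = 0` of the analytic function
`z ↦ P(ψ(z))`, `ψ` representing `τ_g ∘ Φ` near `0` (`= ∞` if it vanishes identically);
`codim_A(A ∩ G') = d - d'`; `H(V; d₁, …, d_p)` = `(dim V)!` × top part of the multihomogeneous
Hilbert–Samuel polynomial, `H(V; d) = deg V · d^{dim V}` for `p = 1`.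
**Théorème 2.1.** *Soit `T ∈ ℕ`, on suppose qu'un polynôme `P` de multidegré `(D₁, …, D_p)` de
`R` s'annule à un ordre `≥ nT + 1` le long de `A` en chaque point de `Σ(n)`. Alors il existe un
sous-groupe algébrique connexe `G'` de `G`, incomplètement défini dans `G` par des équations
multihomogènes de multidegrés `≤ (c₁D₁, …, c_pD_p)`, contenu dans un translaté de `G ∩ 𝒵(P)` et
tel que `binom(T + codim_A(A ∩ G'), codim_A(A ∩ G')) · card((Σ + G')/G') · H(G'; D₁, …, D_p)
≤ H(G; c₁D₁, …, c_pD_p)`,* with integers `cᵢ ≥ 1` depending only on the embedding of `Gᵢ`.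

## The instance vendored (dictionary)

* `K = ℂ`, `p = 1`, `G = G₁ = M_κ = 𝔾ₘ^β × P_κ` (`SemistableQuotients.lean`) for a lattice with
  algebraic invariants and **no complex multiplication** and `κ ∈ ℚ̄^{δ×γ}`; `n = |β| + |γ| + |δ|`;
  embedded in ONE `ℙ^N`, `N + 1 = (|β|+1)·3^{|γ|}·(|δ|+1)`, by the theta functions `Θ_J`
  (`GaGmE.Std.theta`, Segre product of `𝔾ₘ^β ⊂ ℙ^β` with `P_κ ⊂ ℙ(H⁰(P̄_κ, |∑_b 3F_{0,b} + D_∞|))`);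
* a form `P` of degree `D` (`MvPolynomial.IsHomogeneous P D`, coefficients in `ℂ`) that is
  non-zero in `R_D`, i.e. not in the ideal of `G`: its entire function `F_P = P(Θ)` on `Lie M_κ,ℂ`
  (`GaGmE.Std.thetaEval`) is not identically zero (`exp` is onto `M_κ(ℂ)`);
* `A = exp(𝔟)` for a subspace `𝔟 ≠ 0` of `Lie M_κ,ℂ`, `d = dim 𝔟`;
* `Σ = {0, g, 2g, …, Sg}`, `g = exp(v)` (`v ∈ Lie M_κ,ℂ` arbitrary), so `Σ ∋ 0` and
  `Σ(n) = {s·g ; 0 ≤ s ≤ nS}`;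
* `ord_{sg} P ≥ nT + 1` along `A`: `GaGmE.Std.VanishesAlong 𝔟 F_P (s·v) (nT + 1)` — for every
  direction `x ∈ 𝔟`, `ξ ↦ F_P(s·v + ξx)` vanishes to order `≥ nT + 1` at `0`; this is the printed
  order (near `s·v`, `P(ψ(z)) = F_P(s·v + z)/Θ_{J₀}(s·v + z)^D` with `Θ_{J₀}(s·v) ≠ 0`,
  `GaGmE.Std.exists_theta_ne_zero`, and the order of an analytic function of `z ∈ 𝔟` at `0` is the
  least order of its restrictions to lines; `F_P(· + k) = c^D F_P` for `k ∈ ker exp`,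
  `GaGmE.Std.exists_theta_add_ker`, so nothing depends on the lift);
* `G'`: a connected algebraic subgroup of `M_κ,ℂ`; as `E` has no CM these are classified exactly
  as in `SemistableQuotients.lean` / `AnalyticSubgroupSemistable.lean` but over `K = ℂ`
  (vector parts `Ξ ≤ ℂ^δ`): `GaGmE.Std.SubgroupDataC`, with Lie algebra `SubgroupDataC.tangent`;
  `dim G' = dim Lie G'`; "contained in a translate of `G ∩ 𝒵(P)`": `F_P(w₀ + w) = 0` for all
  `w ∈ Lie G'` and some `w₀` (`G' = exp(Lie G')` being connected);
* `codim_A(A ∩ G') = dim 𝔟 - dim(𝔟 ∩ Lie G')` (`exp⁻¹(G') = Lie G' + ker`, and `ker` is discrete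
  modulo `Lie G'`, so the identity component of `A ∩ G'` is `exp(𝔟 ∩ Lie G')`);
* `card((Σ + G')/G')` = the number of classes of `0, v, …, S·v` modulo `Lie G' + ker(exp)`
  (`GaGmE.Std.orbitCard`);
* `H(G'; D) = deg G' · D^{dim G'} ≥ D^{dim G'}` and `H(G; c₁D) = deg M_κ · c₁^n · D^n`: with
  `c := deg M_κ · c₁^n` the printed inequality gives the one below; the factor `deg G' ≥ 1` and the
  clause "incomplètement défini par des équations de degré `≤ c₁D`" are DROPPED (weakening only),
  exactly as in `PhilipponZeroEstimate.lean`.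

Users take `(h : philippon1986_std)`. A discharge needs the theory of multihomogeneous
Hilbert–Samuel functions (op. cit. §3) — not in Mathlib.

## References

* P. Philippon, *Lemmes de zéros dans les groupes algébriques commutatifs*, Bull. Soc. Math.
  France 114 (1986), 355–383: §2, Théorème 2.1 (p. 358); errata 115 (1987), 397–398.
* A. Baker, G. Wüstholz, *Logarithmic Forms and Diophantine Geometry*, CUP 2007, §6.7 (Thm. 6.14
  and p. 114), §6.8.
* G. Wüstholz, *Multiplicity estimates on group varieties*, Ann. of Math. 129 (1989), 471–500.
-/

noncomputable section

open Complex
open scoped PeriodPair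

namespace Literature.NumberTheory.Transcendental

namespace GaGmE

namespace Std

variable {β γ δ : Type} [Fintype β] [Fintype γ] [Fintype δ] [DecidableEq γ]
variable (L : PeriodPair) (κM : δ → γ → Kbar)

/-! ### Forms in the theta functions and orders of vanishing -/

/-- **The entire function `F_P = P(Θ)` on `Lie M_κ,ℂ`** attached to a polynomial `P ∈ ℂ[X_J]` in
the projective coordinates `X_J ↔ Θ_J` of `M_κ` (`GaGmE.Std.theta`): for a form `P` of degree
`D` this is the section `P|_G ∈ R_D` pulled back to the Lie algebra
(`F_P(w) = Θ_{J₀}(w)^D · (P/X_{J₀}^D)(exp w)` on `{Θ_{J₀} ≠ 0}`). Forms with algebraic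
coefficients are used through `MvPolynomial.map (algebraMap Kbar ℂ)`. [cite: Philippon1986, §2 (R, 𝒵(P))] -/
def thetaEval (P : MvPolynomial (Option β × ThetaIdx γ δ) ℂ) (w : β ⊕ (γ ⊕ δ) → ℂ) : ℂ :=
  MvPolynomial.eval (fun J => theta L κM J w) P

/-- **Order of vanishing along a subspace.** `F` vanishes to order at least `N` at `w` along the
subspace `𝔟`: for every direction `x ∈ 𝔟` the one-variable function `ξ ↦ F(w + ξx)` vanishes to
order `≥ N` at `ξ = 0` (all derivatives of order `< N` vanish). For `F` analytic this is the
vanishing of the Taylor expansion of `z ↦ F(w + z)`, `z ∈ 𝔟`, below degree `N` (a symmetric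
`k`-linear form vanishes iff its diagonal does — polarisation), i.e. Philippon's
`ord ≥ N` for the analytic function `z ↦ P(ψ(z))` on `𝔟 ≅ ℂ^d` (§2, p. 358), equivalently the
vanishing of all `(T_g L₁^{t₁}⋯L_d^{t_d} r)(0)`, `t₁ + ⋯ + t_d < N` (Baker–Wüstholz §6.7). The
one-variable form is the one Baker's method uses (restriction to the line `ℂ·v`).
[cite: Philippon1986, §2 (ord_g P)] [cite: BakerWustholz2007, §6.7 (p. 113, order of r at g)] -/
def VanishesAlong (𝔟 : Submodule ℂ (β ⊕ (γ ⊕ δ) → ℂ)) (F : (β ⊕ (γ ⊕ δ) → ℂ) → ℂ)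
    (w : β ⊕ (γ ⊕ δ) → ℂ) (N : ℕ) : Prop :=
  ∀ x ∈ 𝔟, ∀ k < N, iteratedDeriv k (fun ξ : ℂ => F (w + ξ • x)) 0 = 0

omit [Fintype β] [Fintype δ] in
/-- `F_{X_J} = Θ_J`. [folklore] -/
@[simp] theorem thetaEval_X (J : Option β × ThetaIdx γ δ) (w : β ⊕ (γ ⊕ δ) → ℂ) :
    thetaEval L κM (MvPolynomial.X J) w = theta L κM J w := by
  simp [thetaEval]

omit [Fintype β] [Fintype δ] in
/-- `F_{PQ} = F_P F_Q`. [folklore] -/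
theorem thetaEval_mul (P Q : MvPolynomial (Option β × ThetaIdx γ δ) ℂ)
    (w : β ⊕ (γ ⊕ δ) → ℂ) :
    thetaEval L κM (P * Q) w = thetaEval L κM P w * thetaEval L κM Q w := by
  simp [thetaEval]

omit [Fintype β] [Fintype γ] [Fintype δ] [DecidableEq γ] in
/-- Order `≥ 0` is no condition. [folklore] -/
@[simp] theorem vanishesAlong_zero (𝔟 : Submodule ℂ (β ⊕ (γ ⊕ δ) → ℂ))
    (F : (β ⊕ (γ ⊕ δ) → ℂ) → ℂ) (w : β ⊕ (γ ⊕ δ) → ℂ) : VanishesAlong 𝔟 F w 0 :=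
  fun _ _ _ hk => absurd hk (Nat.not_lt_zero _)

omit [Fintype β] [Fintype γ] [Fintype δ] [DecidableEq γ] in
/-- Order `≥ N` implies order `≥ N'` for `N' ≤ N`. [folklore] -/
theorem VanishesAlong.mono {𝔟 : Submodule ℂ (β ⊕ (γ ⊕ δ) → ℂ)} {F : (β ⊕ (γ ⊕ δ) → ℂ) → ℂ}
    {w : β ⊕ (γ ⊕ δ) → ℂ} {N N' : ℕ} (h : VanishesAlong 𝔟 F w N) (hN : N' ≤ N) :
    VanishesAlong 𝔟 F w N' :=
  fun x hx k hk => h x hx k (lt_of_lt_of_le hk hN)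

omit [Fintype β] [Fintype γ] [Fintype δ] [DecidableEq γ] in
/-- Order `≥ 1` along any subspace just means `F(w) = 0`. [folklore] -/
theorem vanishesAlong_one_iff (𝔟 : Submodule ℂ (β ⊕ (γ ⊕ δ) → ℂ)) (F : (β ⊕ (γ ⊕ δ) → ℂ) → ℂ)
    (w : β ⊕ (γ ⊕ δ) → ℂ) : VanishesAlong 𝔟 F w 1 ↔ F w = 0 := by
  constructor
  · intro h
    simpa using h 0 (Submodule.zero_mem _) 0 Nat.zero_lt_one
  · intro h x _ k hk
    obtain rfl : k = 0 := Nat.lt_one_iff.mp hk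
    simpa using h

/-! ### Connected algebraic subgroups of `M_κ,ℂ` (over `K = ℂ`) -/

/-- **Connected algebraic subgroups of `M_κ,ℂ = (𝔾ₘ^β × P_κ)_ℂ`** (`E` without complex
multiplication), in the dual form of `GaGmE.Std.SubgroupData` but over the algebraically closed
field `K = ℂ` of Philippon's theorem: rational characters `A ≤ ℚ^β` of the torus killing the
subgroup, rational homomorphisms `C ≤ ℚ^γ = Hom(E^γ, E) ⊗ ℚ` killing its abelian part, and a
`ℂ`-subspace `Ξ ≤ ℂ^δ` of additive characters of the vector part `𝔾ₐ^δ` killing its vector part,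
with the compatibility `ξ ∘ κ ∈ span_ℂ C` (the vector part contains the `Lie`-image of the abelian
part under the push-out). Over `ℂ` the first two data are still rational (subtori and abelian
subvarieties of `E^γ`, `End E = ℤ`, are rigid) while the third ranges over all complex subspaces.
[folklore] -/
structure SubgroupDataC (β γ δ : Type) [Fintype β] [Fintype γ] [Fintype δ] (κM : δ → γ → Kbar)
    where
  /-- Rational characters of `𝔾ₘ^β` killing `Lie G'`. -/
  A : Submodule ℚ (β → ℚ)
  /-- Rational homomorphisms `E^γ → E` killing the abelian part of `G'`. -/
  C : Submodule ℚ (γ → ℚ)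
  /-- Complex additive characters of `𝔾ₐ^δ` killing the vector part of `G'`. -/
  Ξ : Submodule ℂ (δ → ℂ)
  /-- Compatibility `V ⊇ Lie`-image of the abelian part: `ξ ∘ κ ∈ span_ℂ C` for `ξ ∈ Ξ`. -/
  compat : ∀ ξ ∈ Ξ, (fun b => ∑ e, ξ e * (κM e b : ℂ)) ∈
    Submodule.span ℂ ((fun c : γ → ℚ => fun b => (c b : ℂ)) '' (C : Set (γ → ℚ)))

namespace SubgroupDataC

variable {κM}

/-- **The Lie algebra `Lie G'_ℂ ⊆ Lie M_κ,ℂ`** of the connected algebraic subgroup with data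
`(A, C, Ξ)`: `∑ q_j y'_j = 0` (`q ∈ A`), `∑ c_b z'_b = 0` (`c ∈ C`), `∑ ξ_e s_e = 0` (`ξ ∈ Ξ`).
[folklore] -/
def tangent (K : SubgroupDataC β γ δ κM) : Submodule ℂ (β ⊕ (γ ⊕ δ) → ℂ) where
  carrier := {w | (∀ q ∈ K.A, ∑ j, (q j : ℂ) * w (iy j) = 0) ∧
    (∀ c ∈ K.C, ∑ b, (c b : ℂ) * w (iz b) = 0) ∧ ∀ ξ ∈ K.Ξ, ∑ e, ξ e * w (is e) = 0}
  zero_mem' := by simp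
  add_mem' := by
    rintro v w ⟨hvA, hvC, hvΞ⟩ ⟨hwA, hwC, hwΞ⟩
    refine ⟨fun q hq => ?_, fun c hc => ?_, fun ξ hξ => ?_⟩
    · simp only [Pi.add_apply, mul_add, Finset.sum_add_distrib, hvA q hq, hwA q hq, add_zero]
    · simp only [Pi.add_apply, mul_add, Finset.sum_add_distrib, hvC c hc, hwC c hc, add_zero]
    · simp only [Pi.add_apply, mul_add, Finset.sum_add_distrib, hvΞ ξ hξ, hwΞ ξ hξ, add_zero]
  smul_mem' := by
    rintro a w ⟨hA, hC, hΞ⟩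
    refine ⟨fun q hq => ?_, fun c hc => ?_, fun ξ hξ => ?_⟩
    · simp only [Pi.smul_apply, smul_eq_mul, mul_left_comm _ a, ← Finset.mul_sum, hA q hq,
        mul_zero]
    · simp only [Pi.smul_apply, smul_eq_mul, mul_left_comm _ a, ← Finset.mul_sum, hC c hc,
        mul_zero]
    · simp only [Pi.smul_apply, smul_eq_mul, mul_left_comm _ a, ← Finset.mul_sum, hΞ ξ hξ,
        mul_zero]

omit [DecidableEq γ] in
/-- Membership in `Lie G'`. [folklore] -/
theorem mem_tangent_iff (K : SubgroupDataC β γ δ κM) (w : β ⊕ (γ ⊕ δ) → ℂ) :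
    w ∈ K.tangent ↔ (∀ q ∈ K.A, ∑ j, (q j : ℂ) * w (iy j) = 0) ∧
      (∀ c ∈ K.C, ∑ b, (c b : ℂ) * w (iz b) = 0) ∧ ∀ ξ ∈ K.Ξ, ∑ e, ξ e * w (is e) = 0 :=
  Iff.rfl

variable (κM) in
/-- The whole group `M_κ` (`A = 0`, `C = 0`, `Ξ = 0`). [folklore] -/
def top : SubgroupDataC β γ δ κM where
  A := ⊥
  C := ⊥
  Ξ := ⊥
  compat := by
    intro ξ hξ
    rw [Submodule.mem_bot] at hξ
    subst hξ
    simp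

omit [DecidableEq γ] in
/-- `Lie M_κ = ⊤`. [folklore] -/
theorem tangent_top : (top κM : SubgroupDataC β γ δ κM).tangent = ⊤ := by
  rw [eq_top_iff]
  rintro w -
  refine ⟨fun q hq => ?_, fun c hc => ?_, fun ξ hξ => ?_⟩
  · change q ∈ (⊥ : Submodule ℚ (β → ℚ)) at hq
    rw [Submodule.mem_bot] at hq; subst hq; simp
  · change c ∈ (⊥ : Submodule ℚ (γ → ℚ)) at hc
    rw [Submodule.mem_bot] at hc; subst hc; simp
  · change ξ ∈ (⊥ : Submodule ℂ (δ → ℂ)) at hξ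
    rw [Submodule.mem_bot] at hξ; subst hξ; simp

end SubgroupDataC

/-! ### The count `card((Σ + G')/G')` -/

/-- `exp⁻¹(G')` for the connected algebraic subgroup `G' = exp(Lie G')`: the subgroup
`Lie G' + ker(exp_{M_κ})` of `Lie M_κ,ℂ`. [folklore] -/
def preimageSubgroup (K : SubgroupDataC β γ δ κM) : AddSubgroup (β ⊕ (γ ⊕ δ) → ℂ) :=
  K.tangent.toAddSubgroup ⊔ AddSubgroup.closure (ker L κM)

/-- **`card((Σ + G')/G')` for `Σ = {0, g, …, Sg}`, `g = exp v`**: the number of classes of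
`0, v, 2v, …, Sv` modulo `exp⁻¹(G') = Lie G' + ker`. [cite: Philippon1986, Thm 2.1 (card((Σ+G')/G'))] -/
def orbitCard (K : SubgroupDataC β γ δ κM) (v : β ⊕ (γ ⊕ δ) → ℂ) (S : ℕ) : ℕ :=
  Set.ncard (Set.range fun s : Fin (S + 1) =>
    (QuotientAddGroup.mk ((s : ℂ) • v) : (β ⊕ (γ ⊕ δ) → ℂ) ⧸ preimageSubgroup L κM K))

end Std

end GaGmE

/-! ### The named fact -/

open GaGmE GaGmE.Std in
/-- NAMED FACT — **Philippon's zero estimate (1986, Théorème 2.1) on the group varieties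
`M_κ = 𝔾ₘ^β × P_κ` embedded by theta functions.** Let `Λ` have algebraic invariants `g₂, g₃` and
no complex multiplication, `κ ∈ ℚ̄^{δ×γ}`, `M_κ ⊂ ℙ^N` embedded by the theta functions `Θ_J` of
`PkappaTheta.lean`, `n = dim M_κ`. There is `c > 0` (depending only on these data) such that: for a
subspace `𝔟 ≠ 0` of `Lie M_κ,ℂ` (analytic subgroup `A = exp 𝔟`), a point `g = exp v`, a form
`P` of degree `D ≥ 1` over `ℂ` not vanishing identically on `M_κ` (`F_P = P(Θ) ≢ 0`) and integers
`S ≥ 1`, `T ≥ 0`, if `F_P` vanishes to order `≥ nT + 1` along `𝔟` at `s·v` for all `0 ≤ s ≤ nS`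
(the points of `Σ(n)`, `Σ = {0, g, …, Sg}`), then there is a connected algebraic subgroup `G'` of
`M_κ,ℂ` (`GaGmE.Std.SubgroupDataC`), contained in a translate of the zero set of `P`
(`F_P(w₀ + Lie G') = 0`, hence `G' ≠ M_κ`), with
`binom(T + e, e) · card((Σ + G')/G') · D^{dim G'} ≤ c · D^n`,
`e = dim 𝔟 - dim(𝔟 ∩ Lie G')` — the printed inequality read through `H(G'; D) ≥ D^{dim G'}`,
`H(G; c₁D) = deg M_κ c₁^n D^n`. See the module docstring for the printed statement and the
dictionary; users take `(h : philippon1986_std)`. [cite: Philippon1986, Thm 2.1] -/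
def philippon1986_std : Prop :=
  ∀ (L : PeriodPair), IsAlgebraic ℚ L.g₂ → IsAlgebraic ℚ L.g₃ → ¬ L.HasCM →
    ∀ (β γ δ : Type) [Fintype β] [Fintype γ] [Fintype δ] [DecidableEq γ] (κM : δ → γ → Kbar),
      ∃ c : ℝ, 0 < c ∧ ∀ (𝔟 : Submodule ℂ (β ⊕ (γ ⊕ δ) → ℂ)) (v : β ⊕ (γ ⊕ δ) → ℂ)
        (P : MvPolynomial (Option β × ThetaIdx γ δ) ℂ) (D S T : ℕ),
        0 < Module.finrank ℂ 𝔟 → 1 ≤ D → 1 ≤ S → P.IsHomogeneous D → (∃ w, thetaEval L κM P w ≠ 0) →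
        (∀ s : ℕ, s ≤ Fintype.card (β ⊕ (γ ⊕ δ)) * S →
          VanishesAlong 𝔟 (thetaEval L κM P) ((s : ℂ) • v) (Fintype.card (β ⊕ (γ ⊕ δ)) * T + 1)) →
        ∃ K : SubgroupDataC β γ δ κM,
          (∃ w₀, ∀ w ∈ K.tangent, thetaEval L κM P (w₀ + w) = 0) ∧
          (Nat.choose (T + (Module.finrank ℂ 𝔟 - Module.finrank ℂ ↥(𝔟 ⊓ K.tangent)))
              (Module.finrank ℂ 𝔟 - Module.finrank ℂ ↥(𝔟 ⊓ K.tangent)) : ℝ) *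
            (orbitCard L κM K v S : ℝ) * (D : ℝ) ^ Module.finrank ℂ K.tangent ≤
            c * (D : ℝ) ^ Fintype.card (β ⊕ (γ ⊕ δ))

end Literature.NumberTheory.Transcendental

end
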